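import Summits.ABC.IUTFork.Repair.RHQ3LTailSigma8
import Summits.ABC.IUTFork.Repair.RHQ3LTail
import HarnessLib

/-!
# D-0079 RESCUE sub-cell R-H, ROUND 2 Q3 — the per-curve l-tail TARGET of row 8 «heightclass» (Σ₈), typed and PROVED for `K/ℚ` Galois
# (seat abc-iut-rh2-q3-typ-1 g2)

DEFINITION + proof companion of `RHQ3LTail` p470687 (abc-iut-rh2-q3-typ-1 g0: the row-3 / row-5 targets `LTailSigma3` / `LTailSigma5`, both proved) and
`RHQ3LTailSigma8` (this seat: `inSigma8_of_ltail_of_isGalois`). Rung LADDER-ABC:A2.RESCUE.H; charge director-abc g3 2026-08-26T19:46:32Z (10) «type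
'∃ l₀, ∀ l ≥ l₀, every genuine admissible datum lies in Σ_row' per kept row as kernel targets … prove or refute»; ROUND2/START-HERE §0 (row 8 is a
DATUM-stratum row: Σ₈ = «`HBand` holds at every cell of the datum», abc-iut-rh2-xi-2's `RH.InSigmaDatum.InSigma8 D`). TAKES NO SIDE on [IUTchIII] Cor. 3.12
or on any author; nothing here asserts abc; `HBand` / `InSigma8` are row 8's claim-tagged HYPOTHESES (abc-iut-lens-strengthen-1 / abc-iut-rh-typ-8 p459046 /
p470383), consumed BY NAME; «in Σ₈» = the hypothesis holds as typed at that `l`, never «S holds».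

READING. As in `RHQ3LTail`: a genuine datum is a [IUTchI] Def. 3.1 initial Θ-datum `D : InitialThetaData F K Fbar E l Pb`; `l` and `K = F(E_F[l])` are
PART of it, so the l-tail of «a datum» is the curve side `(F, E_F)` with ANY Def. 3.1 datum of level `l` over it. Row 8's band form `HBand` carries a
fibre-UNIFORMITY clause (one ramification index over each bad `p`) that is NOT a height condition: it fails for all large `l` whenever `F` has a good and a
bad place over one `p`, and it HOLDS whenever `K/ℚ` is Galois (`RH.Q3LTailSigma8.ramIdx_placeOf_eq_of_isGalois`) — the case of every family of record
(HEX λ_k, Frey–Legendre, `F_mod = ℚ`). The target below therefore quantifies over the data of level `l` over `(F, E)` WITH `K/ℚ` GALOIS; on that range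
Q3(row 8) is YES per curve: `lTailSigma8_holds`, `l₀ := max_{v ∣ Δ_min} p_v^{ord_v(Δ_min)+1}` (crude; the exact per-place law is
`RH.Q3LTailSigma8.inSigma8_iff_topQuadratic` / abc-iut-rh-typ-2's `RHQ3L0Exact`, numerics of record abc-iut-rh-num-1 `Q3-L0EXACT-rh-num-1.tsv`: `l₀` is
EXPONENTIAL in the local height `ord_v(q_v)/e(v|p)`). Rows 15 ⊋ 8 (abc-iut-rh-typ-12 `RHSlotReach`, cellwise containment `RHHeightClassGlue.slotReachWindow_of_hBand`
p460910) inherit the same tail. The UNIFORM reading (one `l₀` for all curves) stays false in substance and is not typed here (`RHQ3LTail` docstring).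
[cite: Mochizuki2012, IUTchI Def. 3.1 (b)(c) pp. 61–62, Ex. 3.2 (iv) p. 71; IUTchIV Prop. 1.2 (i)(ii) p. 10] [cite: SilvermanAEC2009, VII.5 Prop. 5.1(b), VIII.8]
[cite: DupuyHilado2025, §3.3, §3.4] [claim: Mochizuki2012, status: disputed] for every IUT locution.
-/

noncomputable section

open Set Function NumberField IsDedekindDomain

namespace Summit.ABC.IUTFork.Repair.RH.Q3LTailSigma8

open Literature.IUT.LogThetaLattice Literature.IUT.LogVolume Literature.IUT.HodgeTheaters
open Summit.ABC.IUTFork.Thm311 Summit.ABC.IUTFork.Thm311.Real Summit.ABC.IUTFork.Cor312Prov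

section Target

variable (F : Type) [Field F] [NumberField F] (E : WeierstrassCurve F) [E.IsElliptic]

/-- **Q3 TARGET, ROW 8 (per-curve l-tail, Galois data)** [R-H round 2, kernel target]: «∃ l₀(E), ∀ l ≥ l₀, EVERY [IUTchI] Def. 3.1 initial Θ-datum of
level `l` over `(F, E_F)` whose extension field `K = F(E_F[l])` is Galois over `ℚ` lies in Σ₈», i.e. abc-iut-rh2-xi-2's `RH.InSigmaDatum.InSigma8 D`
(= abc-iut-rh-typ-8's `HBand (pilotDataOfK D K)`) holds. The Galois guard supplies `HBand`'s fibre-uniformity clause (not a height condition; see the module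
docstring); «admissible» side conditions only shrink the range. PROVED below (`lTailSigma8_holds`). [R-H target over a HYPOTHESIS class — not a fact about S]
[cite: Mochizuki2012, IUTchI Def. 3.1 pp. 61–63; IUTchIV Prop. 1.2 (i)(ii) p. 10] [claim: Mochizuki2012, status: disputed] -/
@[claim "Mochizuki2012" "disputed"]
def LTailSigma8 : Prop :=
  ∃ l₀ : ℕ, ∀ l : ℕ, l₀ ≤ l →
    ∀ (K Fbar : Type) [Field K] [NumberField K] [Algebra F K] [Field Fbar] [Algebra F Fbar] [Algebra K Fbar]
      (Pb : BadPlacePredicates K) (D : InitialThetaData F K Fbar E l Pb), IsGalois ℚ K → RH.InSigmaDatum.InSigma8 D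

/-- **Q3(row 8) = YES per curve on Galois data**: `LTailSigma8 F E` holds with `l₀ := max {p_v^{ord_v(Δ_min)+1} : ord_v(Δ_min) ≠ 0}` (a finite max:
Silverman VIII.8, `WeierstrassCurve.finite_setOf_ordMinimalDiscriminant_ne_zero_holds`; every bad place of a Def. 3.1 datum is multiplicative, VII.5.1(b)).
At `l ≥ l₀` the tail test of `RH.Q3LTailSigma8.inSigma8_of_ltail_of_isGalois` holds at every bad place with `t := ord_v(q_v) + 1` (`p^t ≤ l`,
`ord_v(q_v) + 4e(v|p) ≤ 4e(v|p)·(ord_v(q_v)+1)`); the untied certificate and the fibre uniformity are theorems there. This `l₀` is EXPONENTIAL in the local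
heights; the exact law is `inSigma8_iff_topQuadratic`. [cite: SilvermanAEC2009, VII.5 Prop. 5.1(b), VIII.8] [claim: Mochizuki2012, status: disputed] -/
theorem lTailSigma8_holds : LTailSigma8 F E := by
  classical
  have hfin : {v : HeightOneSpectrum (𝓞 F) | E.ordMinimalDiscriminant v ≠ 0}.Finite :=
    E.finite_setOf_ordMinimalDiscriminant_ne_zero_holds (A := 𝓞 F)
  refine ⟨hfin.toFinset.sup (fun v => residueChar F v ^ (qParamOrd E v + 1)), fun l hl K Fbar _ _ _ _ _ _ Pb D hGal => ?_⟩
  haveI := hGal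
  refine inSigma8_of_ltail_of_isGalois D fun pp w hw => ?_
  haveI : Fact (pp : ℕ).Prime := ⟨pp.2⟩
  set v := finBelow F K (placeOf (pilotDataOfK D K) pp.1 w) with hv
  have hVF : FinitePlace.mk v ∈ D.VFbad := (mem_pilotDataOfK_S_iff D K _).mp hw
  have hmult : E.HasMultiplicativeReductionAt v := ThetaData.hasMultiplicativeReductionAt_under_of_mem_VFbad D hVF
  have hne : E.ordMinimalDiscriminant v ≠ 0 := E.ordMinimalDiscriminant_ne_zero_of_hasMultiplicativeReductionAt v hmult
  have hvS : v ∈ hfin.toFinset := by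
    rw [Set.Finite.mem_toFinset]
    exact hne
  have hres : residueChar F v = (pp : ℕ) := by
    rw [hv, residueChar_finBelow]
    exact residueChar_eq_of_natCast_mem (pp : ℕ) (natCast_mem_placeOf (pilotDataOfK D K) pp.1 w)
  refine ⟨qParamOrd E v + 1, ?_, ?_⟩
  · calc (pp : ℕ) ^ (qParamOrd E v + 1) = residueChar F v ^ (qParamOrd E v + 1) := by rw [hres]
      _ ≤ hfin.toFinset.sup (fun v => residueChar F v ^ (qParamOrd E v + 1)) :=
          Finset.le_sup (f := fun v => residueChar F v ^ (qParamOrd E v + 1)) hvS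
      _ ≤ l := hl
  · have he : 1 ≤ ramIdx F v := Nat.one_le_iff_ne_zero.mpr (ramIdx_ne_zero F v)
    nlinarith [he, Nat.zero_le (qParamOrd E v)]

/-- **Unconditional-in-`K` form with the uniformity binder explicit**: for EVERY Def. 3.1 datum of level `l ≥ l₀(E)` over `(F, E_F)` whose `K` has a
ramification-uniform fibre over each bad prime, `InSigma8 D` (`RH.Q3LTailSigma8.inSigma8_of_ltail`; same `l₀`). The Galois target is the special case
`RH.Q3LTailSigma8.ramIdx_placeOf_eq_of_isGalois`. [cite: SilvermanAEC2009, VII.5 Prop. 5.1(b), VIII.8] [claim: Mochizuki2012, status: disputed] -/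
theorem exists_l0_inSigma8_of_uniform :
    ∃ l₀ : ℕ, ∀ l : ℕ, l₀ ≤ l →
      ∀ (K Fbar : Type) [Field K] [NumberField K] [Algebra F K] [Field Fbar] [Algebra F Fbar] [Algebra K Fbar]
        (Pb : BadPlacePredicates K) (D : InitialThetaData F K Fbar E l Pb),
        (∀ (pp : Nat.Primes) (w w' : (thetaIndex (pilotDataOfK D K)).Fibre (.inr pp)),
          haveI : Fact (pp : ℕ).Prime := ⟨pp.2⟩
          placeOf (pilotDataOfK D K) pp.1 w ∈ (pilotDataOfK D K).S →
            ramIdx K (placeOf (pilotDataOfK D K) pp.1 w') = ramIdx K (placeOf (pilotDataOfK D K) pp.1 w)) →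
        RH.InSigmaDatum.InSigma8 D := by
  classical
  have hfin : {v : HeightOneSpectrum (𝓞 F) | E.ordMinimalDiscriminant v ≠ 0}.Finite :=
    E.finite_setOf_ordMinimalDiscriminant_ne_zero_holds (A := 𝓞 F)
  refine ⟨hfin.toFinset.sup (fun v => residueChar F v ^ (qParamOrd E v + 1)), fun l hl K Fbar _ _ _ _ _ _ Pb D hunif => ?_⟩
  refine inSigma8_of_ltail D hunif fun pp w hw => ?_
  haveI : Fact (pp : ℕ).Prime := ⟨pp.2⟩
  set v := finBelow F K (placeOf (pilotDataOfK D K) pp.1 w) with hv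
  have hVF : FinitePlace.mk v ∈ D.VFbad := (mem_pilotDataOfK_S_iff D K _).mp hw
  have hmult : E.HasMultiplicativeReductionAt v := ThetaData.hasMultiplicativeReductionAt_under_of_mem_VFbad D hVF
  have hne : E.ordMinimalDiscriminant v ≠ 0 := E.ordMinimalDiscriminant_ne_zero_of_hasMultiplicativeReductionAt v hmult
  have hvS : v ∈ hfin.toFinset := by
    rw [Set.Finite.mem_toFinset]
    exact hne
  have hres : residueChar F v = (pp : ℕ) := by
    rw [hv, residueChar_finBelow]
    exact residueChar_eq_of_natCast_mem (pp : ℕ) (natCast_mem_placeOf (pilotDataOfK D K) pp.1 w)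
  refine ⟨qParamOrd E v + 1, ?_, ?_⟩
  · calc (pp : ℕ) ^ (qParamOrd E v + 1) = residueChar F v ^ (qParamOrd E v + 1) := by rw [hres]
      _ ≤ hfin.toFinset.sup (fun v => residueChar F v ^ (qParamOrd E v + 1)) :=
          Finset.le_sup (f := fun v => residueChar F v ^ (qParamOrd E v + 1)) hvS
      _ ≤ l := hl
  · have he : 1 ≤ ramIdx F v := Nat.one_le_iff_ne_zero.mpr (ramIdx_ne_zero F v)
    nlinarith [he, Nat.zero_le (qParamOrd E v)]

end Target

end Summit.ABC.IUTFork.Repair.RH.Q3LTailSigma8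

end
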